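import Mathlib
import HarnessLib
import Literature.Analysis.FluidPDE.ClassicalSolution
import Literature.Analysis.FluidPDE.ClassicalSolutionRescale
import Literature.Analysis.FluidPDE.WholeSpaceIBP
import Literature.Analysis.FluidPDE.SuitableWeakStability
import Literature.Analysis.FunctionSpaces.SobolevDomain
import Literature.Analysis.FunctionSpaces.TorusTestFunction

/-!
# Stub `stub_farFieldWeakEuler` of the line `Sketch` (crux stmt-AnomalousDissipation-19035,
# `PointSink.SolitonTransplant`): the far field is a pressure-free weak Euler field off the origin

Registered signature (proved here, textually; `E³ = EuclideanSpace ℝ (Fin 3)`, `𝕋³ = UnitAddTorus (Fin 3)`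
are the skeleton's local notations, redeclared below):
```
theorem stub_farFieldWeakEuler :
    ∀ (Q V : E³ → E³) (lam : ℝ), 1 < lam → Continuous Q →
      AEStronglyMeasurable V volume →
      LocallyIntegrableOn (fun x => ‖V x‖ ^ 2) {x : E³ | x ≠ 0} volume →
      (∀ a b : ℝ, 0 < a → a < b → Tendsto (fun k : ℕ =>
        ∫ x in {x : E³ | a < ‖x‖ ∧ ‖x‖ < b},
          ‖(lam ^ k) ^ (2 / 3 : ℝ) • Q (lam ^ k • x) - V x‖ ^ 2) atTop (𝓝 0)) →
      (∀ (k : ℕ) (φ : E³ → E³), ContDiff ℝ ∞ φ → HasCompactSupport φ →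
        (∀ x, VectorCalculus.divergence φ x = 0) →
        ∫ x, ⟪(lam ^ k) ^ (2 / 3 : ℝ) • Q (lam ^ k • x),
            fderiv ℝ φ x ((lam ^ k) ^ (2 / 3 : ℝ) • Q (lam ^ k • x))⟫_ℝ =
          -((lam ^ k) ^ (-(1 / 3 : ℝ))) *
            ∫ x, ⟪(lam ^ k) ^ (2 / 3 : ℝ) • Q (lam ^ k • x), (Δ φ) x⟫_ℝ) →
      (∀ (k : ℕ) (θ : E³ → ℝ), ContDiff ℝ ∞ θ → HasCompactSupport θ →
        ∫ x, ⟪(lam ^ k) ^ (2 / 3 : ℝ) • Q (lam ^ k • x), gradient θ x⟫_ℝ = 0) →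
      (∀ φ : E³ → E³, IsTestFunctionOn ⟨{x : E³ | x ≠ 0}, isOpen_ne⟩ φ →
        (∀ x, VectorCalculus.divergence φ x = 0) →
        ∫ x, ⟪V x, fderiv ℝ φ x (V x)⟫_ℝ = 0) ∧
      (∀ θ : E³ → ℝ, IsTestFunctionOn ⟨{x : E³ | x ≠ 0}, isOpen_ne⟩ θ →
        ∫ x, ⟪V x, gradient θ x⟫_ℝ = 0)
```
Passage to the limit `k → ∞` in the tested identities of the rescalings
`Q_k = (λ^k)^{2/3} Q(λ^k ·)` (viscosity `ν_k = (λ^k)^{-1/3} → 0`). A test field supported off the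
origin has its (compact) support inside an open annulus `A = {a < ‖x‖ < b}`, `0 < a < b`, on which
`Q_k → V` in `L²(A)` (hypothesis), `V ∈ L²(A)` (local integrability of `‖V‖²` off the origin on the
compact closed annulus) and `Q_k ∈ L²(A)` (continuity). All whole-space integrals reduce to integrals
over `A` (the derivatives of the tests vanish off their supports), and on the finite measure space
`L²(A)` quadratic pairings `∫_A ⟪Q_k, Dφ·Q_k⟫ → ∫_A ⟪V, Dφ·V⟫` and linear pairings
`∫_A ⟪Q_k, w⟫ → ∫_A ⟪V, w⟫` (`w = Δφ, ∇θ` bounded) pass to the limit (Cauchy–Schwarz; tree lemmas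
`tendsto_integral_inner_clm_apply_of_tendsto_eLpNorm`, `tendsto_integral_inner_of_tendsto_eLpNorm_two_bdd`
of `FluidPDE/SuitableWeakStability`). Since `ν_k → 0`, the right-hand side `-ν_k ∫⟪Q_k, Δφ⟫ → 0`, so
uniqueness of limits gives `∫⟪V, Dφ·V⟫ = 0`; likewise `0 = ∫⟪Q_k, ∇θ⟫ → ∫⟪V, ∇θ⟫`.
Pure proof file (no definitions). [folklore]
-/

-- `Summit.<Summit>.<Problem>` is the tree's mandated summit-side namespace (CONVENTIONS §2); for this
-- single-conjunct summit the two coincide, so the duplicate is deliberate.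
set_option linter.dupNamespace false

noncomputable section

namespace Summit.AnomalousDissipation.AnomalousDissipation.Theorems

open MeasureTheory Filter Topology Set Metric
open scoped InnerProductSpace ContDiff Laplacian
open Literature.Analysis.FunctionSpaces Literature.Analysis.FluidPDE

/-- Physical space `ℝ³` (local notation, as in the registered skeleton). -/
local notation "E³" => EuclideanSpace ℝ (Fin 3)
/-- The flat three-torus (local notation, as in the registered skeleton). -/
local notation "𝕋³" => UnitAddTorus (Fin 3)

/-! ### Geometry of annuli -/

/-- A compact set missing the origin lies in an open annulus `{a < ‖x‖ < b}` with `0 < a < b`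
(the norm attains a positive lower bound on it, and it is bounded). [folklore] -/
theorem farField_exists_annulus {K : Set E³} (hK : IsCompact K) (hK0 : K ⊆ {x : E³ | x ≠ 0}) :
    ∃ a b : ℝ, 0 < a ∧ a < b ∧ K ⊆ {x : E³ | a < ‖x‖ ∧ ‖x‖ < b} := by
  obtain ⟨a', ha', hK'⟩ := hK.exists_forall_le' continuous_norm.continuousOn
    (a := (0 : ℝ)) fun _ hx => norm_pos_iff.2 (hK0 hx)
  obtain ⟨R, hR, hKR⟩ := hK.isBounded.exists_pos_norm_lt
  refine ⟨a' / 2, R + a', by positivity, by linarith, fun x hx => ⟨?_, ?_⟩⟩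
  · linarith [hK' x hx]
  · linarith [hKR x hx]

/-- The closed annulus `{a ≤ ‖x‖ ≤ b}` of `ℝ³` is compact (closed and bounded). [folklore] -/
theorem farField_isCompact_closedAnnulus (a b : ℝ) :
    IsCompact {x : E³ | a ≤ ‖x‖ ∧ ‖x‖ ≤ b} := by
  rw [setOf_and]
  exact Metric.isCompact_of_isClosed_isBounded
    ((isClosed_le continuous_const continuous_norm).inter
      (isClosed_le continuous_norm continuous_const))
    (Metric.isBounded_closedBall (x := (0 : E³)) (r := b) |>.subset fun _ hx =>
      mem_closedBall_zero_iff.2 hx.2)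

/-- The open annulus `{a < ‖x‖ < b}` of `ℝ³` has finite Lebesgue measure. [folklore] -/
theorem farField_volume_annulus_ne_top (a b : ℝ) :
    volume {x : E³ | a < ‖x‖ ∧ ‖x‖ < b} ≠ ⊤ :=
  (lt_of_le_of_lt (measure_mono fun _ hx => mem_closedBall_zero_iff.2 hx.2.le)
    (measure_closedBall_lt_top (x := (0 : E³)) (r := b))).ne

/-! ### `L²` on an annulus -/

/-- A measurable field with `‖V‖²` locally integrable off the origin lies in `L²` of every annulus
`{a < ‖x‖ < b}` with `a > 0` (the closed annulus is a compact subset of `ℝ³ ∖ {0}`). [folklore] -/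
theorem farField_memLp_two_annulus {V : E³ → E³} (hVm : AEStronglyMeasurable V volume)
    (hVloc : LocallyIntegrableOn (fun x => ‖V x‖ ^ 2) {x : E³ | x ≠ 0} volume) {a : ℝ}
    (ha : 0 < a) (b : ℝ) :
    MemLp V 2 (volume.restrict {x : E³ | a < ‖x‖ ∧ ‖x‖ < b}) := by
  have hK : IntegrableOn (fun x => ‖V x‖ ^ 2) {x : E³ | a ≤ ‖x‖ ∧ ‖x‖ ≤ b} volume := by
    refine hVloc.integrableOn_compact_subset (fun x hx h0 => ?_)
      (farField_isCompact_closedAnnulus a b)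
    have h1 : a ≤ ‖x‖ := hx.1
    rw [h0, norm_zero] at h1
    linarith
  exact (memLp_two_iff_integrable_sq_norm hVm.restrict).2
    (hK.mono_set fun _ hx => ⟨hx.1.le, hx.2.le⟩)

/-- A continuous field lies in `L²` of every annulus `{a < ‖x‖ < b}`. [folklore] -/
theorem farField_memLp_two_annulus_of_continuous {u : E³ → E³} (hu : Continuous u) (a b : ℝ) :
    MemLp u 2 (volume.restrict {x : E³ | a < ‖x‖ ∧ ‖x‖ < b}) :=
  (memLp_two_iff_integrable_sq_norm hu.aestronglyMeasurable.restrict).2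
    ((((hu.norm.pow 2).continuousOn.integrableOn_compact
      (farField_isCompact_closedAnnulus a b))).mono_set fun _ hx => ⟨hx.1.le, hx.2.le⟩)

/-- `∫ ‖u_k - V‖² dμ → 0` gives `‖u_k - V‖_{L²(μ)} → 0` for `L²` differences. [folklore] -/
theorem farField_tendsto_eLpNorm_of_tendsto_integral_sq {μ : Measure E³} {u : ℕ → E³ → E³}
    {V : E³ → E³} (hmem : ∀ k, MemLp (u k - V) 2 μ)
    (h : Tendsto (fun k => ∫ x, ‖u k x - V x‖ ^ 2 ∂μ) atTop (𝓝 0)) :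
    Tendsto (fun k => eLpNorm (u k - V) 2 μ) atTop (𝓝 0) := by
  have h' := ENNReal.tendsto_ofReal (h.rpow_const_nhds_zero (p := (2 : ℝ)⁻¹) (by norm_num))
  rw [ENNReal.ofReal_zero] at h'
  refine h'.congr fun k => ?_
  rw [(hmem k).eLpNorm_eq_integral_rpow_norm two_ne_zero ENNReal.ofNat_ne_top]
  simp only [ENNReal.toReal_ofNat, Real.rpow_two, Pi.sub_apply]

/-! ### Pairings on an annulus pass to the limit -/

/-- **Linear pairings.** If `u_k → V` in `L²(A)` (`A` of finite measure) and `w` is a continuous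
compactly supported field vanishing off `A`, then `∫ ⟪u_k, w⟫ → ∫ ⟪V, w⟫` (whole-space integrals;
Cauchy–Schwarz on `A`). [folklore] -/
theorem farField_tendsto_integral_inner {A : Set E³} (hA : volume A ≠ ⊤) {u : ℕ → E³ → E³}
    {V : E³ → E³} (hu : ∀ k, MemLp (u k) 2 (volume.restrict A))
    (hV : MemLp V 2 (volume.restrict A))
    (hlim : Tendsto (fun k => eLpNorm (u k - V) 2 (volume.restrict A)) atTop (𝓝 0))
    {w : E³ → E³} (hw : Continuous w) (hwc : HasCompactSupport w) (hwA : ∀ x ∉ A, w x = 0) :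
    Tendsto (fun k => ∫ x, ⟪u k x, w x⟫_ℝ) atTop (𝓝 (∫ x, ⟪V x, w x⟫_ℝ)) := by
  haveI : IsFiniteMeasure (volume.restrict A) := isFiniteMeasure_restrict.2 hA
  obtain ⟨C, hC⟩ := hw.bounded_above_of_compact_support hwc
  have hC0 : 0 ≤ max C 0 := le_max_right _ _
  have hT := tendsto_integral_inner_of_tendsto_eLpNorm_two_bdd hu hV hlim
    hw.aestronglyMeasurable.restrict hC0 fun x => (hC x).trans (le_max_left _ _)
  have hred : ∀ f : E³ → E³, ∫ x in A, ⟪f x, w x⟫_ℝ = ∫ x, ⟪f x, w x⟫_ℝ := fun f =>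
    setIntegral_eq_integral_of_forall_compl_eq_zero fun x hx => by simp [hwA x hx]
  simpa only [hred] using hT

/-- **Quadratic pairings.** If `u_k → V` in `L²(A)` (`A` of finite measure) and `L` is a
continuous compactly supported operator field vanishing off `A`, then
`∫ ⟪u_k, L u_k⟫ → ∫ ⟪V, L V⟫` (whole-space integrals; Cauchy–Schwarz on `A`). [folklore] -/
theorem farField_tendsto_integral_inner_clm_apply {A : Set E³} (hA : volume A ≠ ⊤)
    {u : ℕ → E³ → E³} {V : E³ → E³} (hu : ∀ k, MemLp (u k) 2 (volume.restrict A))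
    (hV : MemLp V 2 (volume.restrict A))
    (hlim : Tendsto (fun k => eLpNorm (u k - V) 2 (volume.restrict A)) atTop (𝓝 0))
    {L : E³ → E³ →L[ℝ] E³} (hL : Continuous L) (hLc : HasCompactSupport L)
    (hLA : ∀ x ∉ A, L x = 0) :
    Tendsto (fun k => ∫ x, ⟪u k x, L x (u k x)⟫_ℝ) atTop (𝓝 (∫ x, ⟪V x, L x (V x)⟫_ℝ)) := by
  haveI : IsFiniteMeasure (volume.restrict A) := isFiniteMeasure_restrict.2 hA
  obtain ⟨C, hC⟩ := hL.bounded_above_of_compact_support hLc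
  have hC0 : 0 ≤ max C 0 := le_max_right _ _
  have hT := tendsto_integral_inner_clm_apply_of_tendsto_eLpNorm hu hV hlim
    hL.aestronglyMeasurable.restrict hC0 fun x => (hC x).trans (le_max_left _ _)
  have hred : ∀ f : E³ → E³, ∫ x in A, ⟪f x, L x (f x)⟫_ℝ = ∫ x, ⟪f x, L x (f x)⟫_ℝ := fun f =>
    setIntegral_eq_integral_of_forall_compl_eq_zero fun x hx => by simp [hLA x hx]
  simpa only [hred] using hT

/-! ### The limit `k → ∞` -/

/-- **Core of the stub**, for an abstract sequence `u_k` (continuous fields converging to `V` in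
`L²` of every annulus off the origin) satisfying the tested steady Navier–Stokes identities with
viscosities `ν_k → 0`: `V` is a pressure-free weak steady Euler field off the origin and weakly
divergence free there. [folklore] -/
theorem farField_weakEuler_of_tendsto (u : ℕ → E³ → E³) (V : E³ → E³) (ν : ℕ → ℝ)
    (hu : ∀ k, Continuous (u k)) (hVm : AEStronglyMeasurable V volume)
    (hVloc : LocallyIntegrableOn (fun x => ‖V x‖ ^ 2) {x : E³ | x ≠ 0} volume)
    (h1 : ∀ a b : ℝ, 0 < a → a < b → Tendsto (fun k : ℕ =>
        ∫ x in {x : E³ | a < ‖x‖ ∧ ‖x‖ < b}, ‖u k x - V x‖ ^ 2) atTop (𝓝 0))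
    (hν : Tendsto ν atTop (𝓝 0))
    (h2 : ∀ (k : ℕ) (φ : E³ → E³), ContDiff ℝ ∞ φ → HasCompactSupport φ →
        (∀ x, VectorCalculus.divergence φ x = 0) →
        ∫ x, ⟪u k x, fderiv ℝ φ x (u k x)⟫_ℝ = -(ν k) * ∫ x, ⟪u k x, (Δ φ) x⟫_ℝ)
    (h3 : ∀ (k : ℕ) (θ : E³ → ℝ), ContDiff ℝ ∞ θ → HasCompactSupport θ →
        ∫ x, ⟪u k x, gradient θ x⟫_ℝ = 0) :
    (∀ φ : E³ → E³, IsTestFunctionOn ⟨{x : E³ | x ≠ 0}, isOpen_ne⟩ φ →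
        (∀ x, VectorCalculus.divergence φ x = 0) →
        ∫ x, ⟪V x, fderiv ℝ φ x (V x)⟫_ℝ = 0) ∧
      (∀ θ : E³ → ℝ, IsTestFunctionOn ⟨{x : E³ | x ≠ 0}, isOpen_ne⟩ θ →
        ∫ x, ⟪V x, gradient θ x⟫_ℝ = 0) := by
  -- the `L²(A)` package attached to a compact set off the origin
  have pkg : ∀ K : Set E³, IsCompact K → K ⊆ {x : E³ | x ≠ 0} →
      ∃ A : Set E³, K ⊆ A ∧ volume A ≠ ⊤ ∧ (∀ k, MemLp (u k) 2 (volume.restrict A)) ∧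
        MemLp V 2 (volume.restrict A) ∧
        Tendsto (fun k => eLpNorm (u k - V) 2 (volume.restrict A)) atTop (𝓝 0) := by
    intro K hK hK0
    obtain ⟨a, b, ha, hab, hKA⟩ := farField_exists_annulus hK hK0
    have huA := fun k => farField_memLp_two_annulus_of_continuous (hu k) a b
    have hVA := farField_memLp_two_annulus hVm hVloc ha b
    exact ⟨_, hKA, farField_volume_annulus_ne_top a b, huA, hVA,
      farField_tendsto_eLpNorm_of_tendsto_integral_sq (fun k => (huA k).sub hVA) (h1 a b ha hab)⟩
  refine ⟨fun φ hφ hdiv => ?_, fun θ hθ => ?_⟩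
  · obtain ⟨A, hKA, hA, huA, hVA, hlim⟩ := pkg _ hφ.hasCompactSupport hφ.tsupport_subset
    have hφ1 : ContDiff ℝ 1 φ := hφ.contDiff.of_le (by exact_mod_cast le_top)
    have hφ2 : ContDiff ℝ 2 φ := contDiff_infty.1 hφ.contDiff 2
    -- the convective pairing converges to `∫ ⟪V, Dφ V⟫`
    have hconv := farField_tendsto_integral_inner_clm_apply hA huA hVA hlim
      (hφ1.continuous_fderiv one_ne_zero) (hφ.hasCompactSupport.fderiv (𝕜 := ℝ))
      fun _ hx => fderiv_of_notMem_tsupport ℝ fun h => hx (hKA h)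
    -- the viscous pairing converges, hence `-ν_k ∫ ⟪u_k, Δφ⟫ → 0`
    have hΔc : HasCompactSupport (Δ φ) := hφ.hasCompactSupport.mono' fun x hx => by
      contrapose! hx
      simp [laplacian_eq_zero_of_notMem_tsupport hx]
    have hvisc := farField_tendsto_integral_inner hA huA hVA hlim (continuous_laplacian hφ2) hΔc
      fun _ hx => laplacian_eq_zero_of_notMem_tsupport fun h => hx (hKA h)
    have hrhs : Tendsto (fun k => -(ν k) * ∫ x, ⟪u k x, (Δ φ) x⟫_ℝ) atTop (𝓝 0) := by
      simpa using hν.neg.mul hvisc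
    have hlhs : Tendsto (fun k => ∫ x, ⟪u k x, fderiv ℝ φ x (u k x)⟫_ℝ) atTop (𝓝 0) :=
      hrhs.congr fun k => (h2 k φ hφ.contDiff hφ.hasCompactSupport hdiv).symm
    exact tendsto_nhds_unique hconv hlhs
  · obtain ⟨A, hKA, hA, huA, hVA, hlim⟩ := pkg _ hθ.hasCompactSupport hθ.tsupport_subset
    have hθ1 : ContDiff ℝ 1 θ := hθ.contDiff.of_le (by exact_mod_cast le_top)
    have hgc : HasCompactSupport (gradient θ) := hθ.hasCompactSupport.mono' fun x hx => by
      contrapose! hx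
      simp [gradient_eq_zero_of_notMem_tsupport hx]
    have hgrad := farField_tendsto_integral_inner hA huA hVA hlim
      (continuous_gradient_of_contDiff hθ1) hgc
      fun _ hx => gradient_eq_zero_of_notMem_tsupport fun h => hx (hKA h)
    have hzero : Tendsto (fun k => ∫ x, ⟪u k x, gradient θ x⟫_ℝ) atTop (𝓝 0) :=
      tendsto_const_nhds.congr fun k => (h3 k θ hθ.contDiff hθ.hasCompactSupport).symm
    exact tendsto_nhds_unique hgrad hzero

/-- **S4 `stub_farFieldWeakEuler`.** Passage to the limit `k → ∞` in the tested identities of the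
rescalings `Q_k = (λ^k)^{2/3} Q(λ^k ·)` (viscosity `ν_k = (λ^k)^{-1/3} → 0`): for a test field `φ`
with `tsupport φ ⊆ {a < |x| < b} ⋐ ℝ³∖0`, `∫⟪Q_k, Dφ·Q_k⟫ → ∫⟪V, Dφ·V⟫` by Cauchy–Schwarz on the
annulus (`Q_k → V` in `L²(a<|x|<b)`, `‖Q_k‖_{L²(a<|x|<b)}` bounded, `Dφ` bounded) while
`ν_k ∫⟪Q_k, Δφ⟫ → 0`; likewise `0 = ∫⟪Q_k, ∇θ⟫ → ∫⟪V, ∇θ⟫`. Conclusion: `V` is a pressure-free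
weak steady Euler field off the origin and weakly divergence free there. [folklore] -/
theorem stub_farFieldWeakEuler :
    ∀ (Q V : E³ → E³) (lam : ℝ), 1 < lam → Continuous Q →
      AEStronglyMeasurable V volume →
      LocallyIntegrableOn (fun x => ‖V x‖ ^ 2) {x : E³ | x ≠ 0} volume →
      (∀ a b : ℝ, 0 < a → a < b → Tendsto (fun k : ℕ =>
        ∫ x in {x : E³ | a < ‖x‖ ∧ ‖x‖ < b},
          ‖(lam ^ k) ^ (2 / 3 : ℝ) • Q (lam ^ k • x) - V x‖ ^ 2) atTop (𝓝 0)) →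
      (∀ (k : ℕ) (φ : E³ → E³), ContDiff ℝ ∞ φ → HasCompactSupport φ →
        (∀ x, VectorCalculus.divergence φ x = 0) →
        ∫ x, ⟪(lam ^ k) ^ (2 / 3 : ℝ) • Q (lam ^ k • x),
            fderiv ℝ φ x ((lam ^ k) ^ (2 / 3 : ℝ) • Q (lam ^ k • x))⟫_ℝ =
          -((lam ^ k) ^ (-(1 / 3 : ℝ))) *
            ∫ x, ⟪(lam ^ k) ^ (2 / 3 : ℝ) • Q (lam ^ k • x), (Δ φ) x⟫_ℝ) →
      (∀ (k : ℕ) (θ : E³ → ℝ), ContDiff ℝ ∞ θ → HasCompactSupport θ →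
        ∫ x, ⟪(lam ^ k) ^ (2 / 3 : ℝ) • Q (lam ^ k • x), gradient θ x⟫_ℝ = 0) →
      (∀ φ : E³ → E³, IsTestFunctionOn ⟨{x : E³ | x ≠ 0}, isOpen_ne⟩ φ →
        (∀ x, VectorCalculus.divergence φ x = 0) →
        ∫ x, ⟪V x, fderiv ℝ φ x (V x)⟫_ℝ = 0) ∧
      (∀ θ : E³ → ℝ, IsTestFunctionOn ⟨{x : E³ | x ≠ 0}, isOpen_ne⟩ θ →
        ∫ x, ⟪V x, gradient θ x⟫_ℝ = 0) := by
  intro Q V lam hlam hQ hVm hVloc h1 h2 h3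
  exact farField_weakEuler_of_tendsto (fun k x => (lam ^ k) ^ (2 / 3 : ℝ) • Q (lam ^ k • x)) V
    (fun k => (lam ^ k) ^ (-(1 / 3 : ℝ)))
    (fun k => by fun_prop) hVm hVloc h1
    ((tendsto_rpow_neg_atTop (by norm_num : (0 : ℝ) < 1 / 3)).comp
      (tendsto_pow_atTop_atTop_of_one_lt hlam)) h2 h3

end Summit.AnomalousDissipation.AnomalousDissipation.Theorems

end
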